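import Literature.MathematicalPhysics.QuantumFieldTheory.Balaban1983to89.B4ThmJoinFam
import Literature.MathematicalPhysics.QuantumFieldTheory.Balaban1983to89.B2Lemma24KerOmega

/-!
# `Balaban1983to89.B4TorusBoxReindex` — [Balaban1983RegularityDecay] p. 572 «a torus T_η which we identify with a
# rectangular parallelepiped in ηZ^d with periodic conditions»: A PROPER PARALLELEPIPED `Ω` OF THE TORUS HAS NO
# WRAP-AROUND BOND, so its operator (1.6), its Green's function and its covariant derivative (1.3) ARE the lattice box
# objects of the Lemma-2.2 lineage (`B4Lemma22ReduceZero.opA` ∕ `greenA` ∕ `derivA` on `Box d ℓ k Ms`), re-indexed along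
# the translated-box chart `eB` of `B2Lemma24KerOmega` (r01 g7's `boxEmb`)

statement-level skeleton of published theorems with citation tags; proofs where landed; nothing here is a claim about the Yang–Mills mass gap

CITATION HEADER.  T. Bałaban, *Regularity and decay of lattice Green's functions*, Commun. Math. Phys. **89** (1983)
571–597, doi:10.1007/bf01214744 [Balaban1983RegularityDecay] (cell paper B4; held text
`paper:balaban1983-cmp89-regularity-decay`, journal page = PDF page + 570; p. 572 (1.1)–(1.7), p. 573 Theorem).
Cell `pub-ymgap`, Track-A seat `pub-ymgap-dag-p3` gen 3 (node N01 of YM-PLAN §2; payload OPS-REQUESTS l.312 § dag-p3;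
house rules R415; INTENT-3 INBOX l.8866).  File 1 of 2 of the `rect`-residual (α) programme named by this seat's gen 2
(INBOX l.8760 (2)(i)): the Theorem p. 573 WITHOUT the `R₀` restriction for proper parallelepipeds of the torus.  USED BY
NAME, never restated: r01 g9's `B4TorusRegionOp.{torusOp, torusDeriv, torWt, torBond, TNbr, twrap, perField,
fieldLink_tor_eq_of_nbrs, contourTrans_tor_eq, tNbr_of_nbrs, val_mem_perBox}`, pv17's region data
`B4Lower18RegularRegion.{regWt, compField, covOp_congr, transport_congr}`, `B4Lemma21Region.{regionOp, regionDeriv,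
covDeriv, dirKer}`, p23 g19's label box and chart `B2Lemma24KerOmega.{boxLabels, mem_boxLabels, eB, eBquiv, eBι,
eBι_eq, shiftF, eB_surjective, regionOp_submatrix_eB, hnk}` (over r01 g7's `B4RegionCubeCarrier.boxEmb` and p17 g4's
`B4CubeOpReindex.covOp_cut_submatrix`), `B4SubBoxCarrier.mem_nbrs_add_iff`, `B4RegionCubeCarrier.compField_add`,
`B4Lemma22HolderBox.IsNNChain`, and the Lemma-2.2 lineage's `B4Lemma22ReduceZero.{Box, opA, greenA, derivA}` with
p23's `B2Lemma24SupG.{κS, embS, ΓS}` (the carriers of r04∕p17's box-pair family `B4ThmBoxPairEta.BoxPairInst`);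
Mathlib's `Matrix.inv_submatrix_equiv`, `Matrix.submatrix_mulVec_equiv`, `Equiv.iSup_congr`.

WHAT IS PRINTED (p. 572 [PDF 2], verbatim).  «We consider operators on subsets of the lattice ηZ^d, η = L^{−k}. …
Another common case is to consider operators on subsets of a torus T_η which we identify with a rectangular
parallelepiped in ηZ^d with periodic conditions.»; (1.3) «⟨φ,(−Δ^{η,N}_{A,Ω})φ⟩ = Σ_{b⊂Ω} η^d|(D^η_Aφ)(b)|² … where
the summation is over the set of all bonds b = ⟨b_−,b_+⟩ with end-points b_−, b_+ in Ω.»; p. 573 «For some simple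
sets Ω, e.g. for rectangular parallelepipeds, the inequalities hold without any restrictions on the points x, x′».

WHY THIS FILE.  In the tree the parallelepiped waiver of the Theorem is kernel-proved for LATTICE parallelepiped pairs
(`B4ThmBoxPairEtaNoCollar.thmPrintedNN_boxPairFamNC`, `rect := True`), while the torus family of record
(`B4TorusPairFam.torusPairFam`, NODE 00's `famE`) carries the waiver on the full torus only.  A parallelepiped `Ω` of
`T_η` whose label box `o + Π_ν[0, Ms_ν)` misses at least one hyperplane of unit blocks in every direction
(`Ms_ν + 1 ≤ P_ν`) contains no bond that wraps around the torus; read on representatives (as the print does) it IS a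
lattice parallelepiped, and (1.3)–(1.6) on it are the lattice objects.  This module proves exactly that, as operator
identities, so that file 2 (`B4ThmTorusBox`) can transfer the box family's unrestricted (1.9)–(1.10) to such `Ω ⊂ T_η`.

WHAT THIS MODULE PROVES (all in full; `d + 1` lattice dimensions, `n` fine points per unit, torus `Π_ν ℤ/(nP_ν)` read
on its period box; `Ω` = the unit blocks with labels in p23's label box `boxLabels Ms o = o + Π[0,Ms) ⊆ Π_ν[0,P_ν)`).
* §1 NO WRAP-AROUND BONDS (`Ms_ν + 1 ≤ P_ν`): `label_gap` (the labels `0` and `P_ν − 1` are not both met in any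
  direction), **`nbrs_of_tNbr`** (a torus bond of `Ω` is a lattice bond of the representatives), `torWt_eq_regWt`,
  **`torusOp_eq_regionOp`** (`H^T_Ω(A) = H^ℤ_Ω(A^per)` on the SAME carrier), `twrap_add_e1_eq` ∕
  `twrap_add_e1_mem_iff`, **`torusDeriv_eq_regionDeriv`** (`D^T_{A,μ} = D^ℤ_{A^per,μ}`).
* §2 ALONG THE BOX CHART `eB : Box d ℓ k Ms → Ω` (a bijection, p23's `eBquiv`∕`eBι`): **`torusOp_submatrix_eB`**
  (`H^T_Ω(A)` re-indexed = `opA` at the translated periodic field `shiftF ℓ k o A^per`, by p23's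
  `regionOp_submatrix_eB`), **`inv_torusOp_submatrix_eB`** (`G^T_k(Ω,A)` re-indexed = `greenA`),
  `covDeriv_submatrix_eB`, **`torusDeriv_submatrix_eB`** (= `derivA`).
* §3 FIELDS ALONG THE CHART (`f ∘ eBι`): `fld_comp_eBι`, `supN_comp_eBι`, `submatrix_mulVec_comp_eBι`,
  **`inv_torusOp_mulVec_comp_eBι`** ∕ **`torusDeriv_mulVec_comp_eBι`** (`(G^T_Ωf)∘eB = greenA(f∘eB)`,
  `(D^T_μv)∘eB = derivA(v∘eB)`), `transport_map`, **`transport_eB`** (the transporter of a nearest-neighbour chain of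
  the box, read through the chart with the torus links, is the box transporter at the translated periodic component
  field), `isNNChain_map_symm` ∕ **`transport_eq_transport_symm`** (a torus chain of `Ω` read on the box is a
  nearest-neighbour chain with the same transporter), `eB_sub` ∕ `val_eq_symm_add` (differences are unchanged).
HONEST SCOPE.  Lattice∕torus bookkeeping only (no analytic estimate); abelian one-parameter flow `F.U` of the lineage;
fine period `nP_ν ≥ 3` where the torus bond graph must be simple.  THEOREMS ONLY: no `def`, no `Prop`-valued fact, no
`sorry`; axioms standard.  Count-neutral for YM-PLAN (typed 28∕28 · discharged 0∕28 unmoved); nothing here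
concerns the continuum, ℝ⁴, OS axioms, a mass gap or the Clay problem.
-/

namespace Literature.MathematicalPhysics.QuantumFieldTheory.Balaban1983to89.B4TorusBoxReindex

open Literature.MathematicalPhysics.QuantumFieldTheory.Balaban1983to89
open Literature.MathematicalPhysics.QuantumFieldTheory.Balaban1983to89.B4Reflection242 (boxDom mem_boxDom nbrs mem_nbrs
  blk nbrs_comm)
open Literature.MathematicalPhysics.QuantumFieldTheory.Balaban1983to89.B4GaugeCovariance
open Literature.MathematicalPhysics.QuantumFieldTheory.Balaban1983to89.B4Lower18 (fineDom mem_fineDom)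
open Literature.MathematicalPhysics.QuantumFieldTheory.Balaban1983to89.B4Lower18Regular (e1 e1_apply_self e1_apply_ne
  baseEmb stairContour PathRel)
open Literature.MathematicalPhysics.QuantumFieldTheory.Balaban1983to89.B4Lower18RegularRegion (regWt compField
  covOp_congr transport_congr)
open Literature.MathematicalPhysics.QuantumFieldTheory.Balaban1983to89.B4Lemma21Region (regionOp regionDeriv covDeriv
  dirKer siteNorm)
open Literature.MathematicalPhysics.QuantumFieldTheory.Balaban1983to89.B4Lemma22ReduceZero (Box opA greenA derivA)
open Literature.MathematicalPhysics.QuantumFieldTheory.Balaban1983to89.B4Lemma22Reduce231 (supN)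
open Literature.MathematicalPhysics.QuantumFieldTheory.Balaban1983to89.B4Lemma22HolderBox (IsNNChain)
open Literature.MathematicalPhysics.QuantumFieldTheory.Balaban1983to89.B4SubBoxCarrier (mem_nbrs_add_iff)
open Literature.MathematicalPhysics.QuantumFieldTheory.Balaban1983to89.B4RegionCubeCarrier (compField_add)
open Literature.MathematicalPhysics.QuantumFieldTheory.Balaban1983to89.B4TorusRegionOp
open Literature.MathematicalPhysics.QuantumFieldTheory.Balaban1983to89.B2Lemma24SupG (κS embS ΓS)
open Literature.MathematicalPhysics.QuantumFieldTheory.Balaban1983to89.B2Lemma24KerOmega (boxLabels mem_boxLabels eB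
  eBquiv eBι eBι_eq eBquiv_apply shiftF eB_surjective regionOp_submatrix_eB hnk)
open scoped Matrix

noncomputable section

variable {d : ℕ} {ι : Type} [Fintype ι] [DecidableEq ι]

/-! ## §1. A proper parallelepiped of the torus has no wrap-around bond -/

section NoWrap

variable {n : ℕ} (hn : 1 ≤ n) {P : Fin (d + 1) → ℕ} (h3 : ∀ ν, 3 ≤ per n P ν) {Ms : Fin (d + 1) → ℕ}
  {o : Fin (d + 1) → ℤ} (hΩP : boxLabels Ms o ⊆ boxDom P) (hwrap : ∀ ν, Ms ν + 1 ≤ P ν)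

omit [Fintype ι] [DecidableEq ι] in
include hwrap in
/-- **THE LABEL GAP**: a label box `o + Π[0,Ms)` with `Ms_ν + 1 ≤ P_ν` does not contain both a label with
`ν`-coordinate `0` and one with `ν`-coordinate `P_ν − 1` — in every direction at least one hyperplane of unit blocks
of the torus `Π_ν[0,P_ν)` is missed. [cite: Balaban1983RegularityDecay, p.572 «a torus T_η which we identify with a rectangular parallelepiped in ηZ^d with periodic conditions», dictionary] -/
theorem label_gap {y y' : Fin (d + 1) → ℤ} (hy : y ∈ boxLabels Ms o) (hy' : y' ∈ boxLabels Ms o) (ν : Fin (d + 1))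
    (h0 : y ν = 0) (hP : y' ν = (P ν : ℤ) - 1) : False := by
  have h1 := (mem_boxLabels.1 hy) ν
  have h2 := (mem_boxLabels.1 hy') ν
  have h3' : (Ms ν : ℤ) + 1 ≤ (P ν : ℤ) := by exact_mod_cast hwrap ν
  omega

omit [Fintype ι] [DecidableEq ι] in
include hn in
/-- the `ν`-label of a fine point on the top face `x_ν = nP_ν − 1` of the period box is `P_ν − 1`. [cite: Balaban1983RegularityDecay, (1.1) p.572, dictionary] -/
theorem blk_of_top {x : Fin (d + 1) → ℤ} {ν : Fin (d + 1)} (hx : x ν = (per n P ν : ℤ) - 1) :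
    blk n x ν = (P ν : ℤ) - 1 := by
  have hn0 : (0 : ℤ) < n := by exact_mod_cast hn
  show x ν / (n : ℤ) = (P ν : ℤ) - 1
  rw [hx]
  have hper : ((per n P ν : ℕ) : ℤ) = (n : ℤ) * (P ν : ℤ) := by simp [per]
  rw [hper]
  have : (n : ℤ) * (P ν : ℤ) - 1 = ((n : ℤ) - 1) + (n : ℤ) * ((P ν : ℤ) - 1) := by ring
  rw [this, Int.add_mul_ediv_left _ _ hn0.ne', Int.ediv_eq_zero_of_lt (by omega) (by omega), zero_add]

omit [Fintype ι] [DecidableEq ι] in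
/-- the `ν`-label of a fine point on the bottom face `x_ν = 0` is `0`. [cite: Balaban1983RegularityDecay, (1.1) p.572, dictionary] -/
theorem blk_of_bot {x : Fin (d + 1) → ℤ} {ν : Fin (d + 1)} (hx : x ν = 0) : blk n x ν = 0 := by
  show x ν / (n : ℤ) = 0
  rw [hx, Int.zero_ediv]

omit [Fintype ι] [DecidableEq ι] in
include hn hΩP hwrap in
/-- the forward case: `v = twrap(u + e_μ)` with `u, v ∈ Ω` forces `v = u + e_μ` (the reduction is trivial, else the
labels `P_μ − 1` and `0` would both be met). [cite: Balaban1983RegularityDecay, p.572 «periodic conditions», dictionary] -/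
theorem eq_add_e1_of_twrap {u v : Fin (d + 1) → ℤ} (hu : u ∈ fineDom n (boxLabels Ms o))
    (hv : v ∈ fineDom n (boxLabels Ms o)) {μ : Fin (d + 1)} (h : v = twrap n P (u + e1 μ)) : v = u + e1 μ := by
  have hub : u ∈ boxDom (per n P) := val_mem_perBox hn hΩP ⟨u, hu⟩
  by_cases hw : u + e1 μ ∈ boxDom (per n P)
  · rw [h, twrap_eq_self hw]
  · -- `u + e_μ` leaves the period box: `u_μ = nP_μ − 1` and `v_μ = 0`
    exfalso
    have hub' := mem_boxDom.1 hub
    have huμ : u μ = (per n P μ : ℤ) - 1 := by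
      by_contra hne
      apply hw
      rw [mem_boxDom]
      intro i
      by_cases hi : i = μ
      · subst hi
        simp only [Pi.add_apply, e1_apply_self]
        have := hub' i
        omega
      · simp only [Pi.add_apply, e1_apply_ne hi, add_zero]
        exact hub' i
    have hvμ : v μ = 0 := by
      rw [h, twrap_apply]
      simp only [Pi.add_apply, e1_apply_self, huμ, sub_add_cancel]
      exact Int.emod_self
    exact label_gap hwrap ((mem_fineDom hn).1 hv) ((mem_fineDom hn).1 hu) μ (blk_of_bot hvμ) (blk_of_top hn huμ)

omit [Fintype ι] [DecidableEq ι] in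
include hn hΩP hwrap in
/-- **A TORUS BOND OF A PROPER PARALLELEPIPED IS A LATTICE BOND OF ITS REPRESENTATIVES** (no bond of `Ω` wraps around
the torus). [cite: Balaban1983RegularityDecay, p.572 «a torus T_η which we identify with a rectangular parallelepiped in ηZ^d with periodic conditions», (1.3) p.572] -/
theorem nbrs_of_tNbr {u v : Fin (d + 1) → ℤ} (hu : u ∈ fineDom n (boxLabels Ms o)) (hv : v ∈ fineDom n (boxLabels Ms o))
    (h : TNbr n P u v) : v ∈ nbrs u := by
  obtain ⟨μ, h | h⟩ := h
  · rw [eq_add_e1_of_twrap hn hΩP hwrap hu hv h]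
    exact mem_nbrs.2 ⟨μ, Or.inl rfl⟩
  · rw [nbrs_comm, eq_add_e1_of_twrap hn hΩP hwrap hv hu h]
    exact mem_nbrs.2 ⟨μ, Or.inl rfl⟩

omit [Fintype ι] [DecidableEq ι] in
include hn hΩP hwrap in
/-- **THE TORUS BOND WEIGHTS OF A PROPER PARALLELEPIPED ARE THE LATTICE NEUMANN WEIGHTS** of its representatives.
[cite: Balaban1983RegularityDecay, (1.3) p.572] -/
theorem torWt_eq_regWt : torWt n P (fineDom n (boxLabels Ms o)) = regWt n (fineDom n (boxLabels Ms o)) := by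
  funext u v
  unfold torWt regWt
  by_cases huv : v.1 ∈ nbrs u.1
  · rw [if_pos huv, if_pos (tNbr_of_nbrs hn hΩP huv)]
  · rw [if_neg huv, if_neg (fun h => huv (nbrs_of_tNbr hn hΩP hwrap u.2 v.2 h))]

include hn h3 hΩP hwrap in
/-- **`H^T_Ω(A) = H^ℤ_Ω(A^per)`: THE OPERATOR (1.6) OF A PROPER PARALLELEPIPED OF THE TORUS IS THE LATTICE OPERATOR OF
ITS REPRESENTATIVES AT THE PERIODIC FIELD** (same carrier `fineDom n (boxLabels Ms o)`; same unit blocks, block weights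
and staircase contours; no wrap-around bond). [cite: Balaban1983RegularityDecay, (1.3)–(1.6) p.572 «operators on subsets of a torus T_η»] -/
theorem torusOp_eq_regionOp (F : OrthFlow ι) (e a m2 : ℝ) (Ac : (Fin (d + 1) → ℤ) → Fin (d + 1) → ℝ) :
    torusOp F e hn a m2 P (boxLabels Ms o) Ac = regionOp F e hn a m2 (boxLabels Ms o) (perField n P Ac) := by
  rw [torusOp, regionOp, b4Op, b4Op, contourTrans_tor_eq F hn h3 hΩP, torWt_eq_regWt hn hΩP hwrap]
  refine covOp_congr _ _ (fun u v huv => ?_) (fun _ _ _ => rfl)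
  have hnb : v.1 ∈ nbrs u.1 := by
    by_contra hc; exact huv (by simp [regWt, hc])
  exact fieldLink_tor_eq_of_nbrs F hn h3 hΩP (e / n) Ac hnb

omit [Fintype ι] [DecidableEq ι] in
include hn hΩP hwrap in
/-- on a proper parallelepiped, if the reduced forward neighbour `twrap(x + e_μ)` lies in `Ω` then it IS `x + e_μ`.
[cite: Balaban1983RegularityDecay, (1.3) p.572, dictionary] -/
theorem twrap_add_e1_eq {x : Fin (d + 1) → ℤ} (hx : x ∈ fineDom n (boxLabels Ms o)) {μ : Fin (d + 1)}
    (h : twrap n P (x + e1 μ) ∈ fineDom n (boxLabels Ms o)) : twrap n P (x + e1 μ) = x + e1 μ :=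
  eq_add_e1_of_twrap hn hΩP hwrap hx h rfl

omit [Fintype ι] [DecidableEq ι] in
include hn hΩP hwrap in
/-- membership form: `twrap(x + e_μ) ∈ Ω ↔ x + e_μ ∈ Ω`. [cite: Balaban1983RegularityDecay, (1.3) p.572, dictionary] -/
theorem twrap_add_e1_mem_iff {x : Fin (d + 1) → ℤ} (hx : x ∈ fineDom n (boxLabels Ms o)) (μ : Fin (d + 1)) :
    twrap n P (x + e1 μ) ∈ fineDom n (boxLabels Ms o) ↔ x + e1 μ ∈ fineDom n (boxLabels Ms o) := by
  constructor
  · intro h; rwa [← twrap_add_e1_eq hn hΩP hwrap hx h]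
  · intro h; rwa [twrap_eq_self (val_mem_perBox hn hΩP ⟨_, h⟩)]

include hn h3 hΩP hwrap in
/-- **`D^T_{A,μ} = D^ℤ_{A^per,μ}`: THE COVARIANT DERIVATIVE (1.3) OF A PROPER PARALLELEPIPED OF THE TORUS IS THE
LATTICE ONE** at the periodic field (same carrier). [cite: Balaban1983RegularityDecay, (1.3) p.572] -/
theorem torusDeriv_eq_regionDeriv (F : OrthFlow ι) (e : ℝ) (Ac : (Fin (d + 1) → ℤ) → Fin (d + 1) → ℝ)
    (μ : Fin (d + 1)) :
    torusDeriv F e n P (boxLabels Ms o) Ac μ = regionDeriv F e n (boxLabels Ms o) (perField n P Ac) μ := by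
  unfold torusDeriv regionDeriv tcovDeriv covDeriv
  congr 1
  funext x z
  unfold tdirKer dirKer
  by_cases hx : x.1 + e1 μ ∈ fineDom n (boxLabels Ms o)
  · have hx' : twrap n P (x.1 + e1 μ) ∈ fineDom n (boxLabels Ms o) := (twrap_add_e1_mem_iff hn hΩP hwrap x.2 μ).2 hx
    have heq : twrap n P (x.1 + e1 μ) = x.1 + e1 μ := twrap_add_e1_eq hn hΩP hwrap x.2 hx'
    rw [if_pos hx', if_pos hx, heq]
    by_cases hz : z.1 = x.1 + e1 μ
    · have hnb : z.1 ∈ nbrs x.1 := by rw [hz]; exact mem_nbrs.2 ⟨μ, Or.inl rfl⟩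
      rw [if_pos hz, if_pos hz, fieldLink_tor_eq_of_nbrs F hn h3 hΩP (e / n) Ac hnb]
    · rw [if_neg hz, if_neg hz]
  · have hx' : twrap n P (x.1 + e1 μ) ∉ fineDom n (boxLabels Ms o) :=
      fun h => hx ((twrap_add_e1_mem_iff hn hΩP hwrap x.2 μ).1 h)
    rw [if_neg hx', if_neg hx]

end NoWrap

/-! ## §2. Along the box chart: the torus operator, Green's function and derivative are the box lineage's -/

section BoxChart

variable (ℓ k : ℕ) (Ms : Fin (d + 1) → ℕ) (o : Fin (d + 1) → ℤ)

omit [Fintype ι] [DecidableEq ι] in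
/-- coordinates of the chart: `(eB a) = a + n·o`. [cite: Balaban1983RegularityDecay, (1.1) p.572, dictionary] -/
theorem eB_val (a : ↥(Box d ℓ k Ms)) :
    (eB ℓ k Ms o a).1 = a.1 + fun i => (((ℓ + 1) ^ k : ℕ) : ℤ) * o i := rfl

omit [Fintype ι] [DecidableEq ι] in
/-- **DIFFERENCES ARE UNCHANGED BY THE CHART** (a translation). [cite: Balaban1983RegularityDecay, (1.9) p.573 «|x − x′|», dictionary] -/
theorem eB_sub (a b : ↥(Box d ℓ k Ms)) : (eB ℓ k Ms o a).1 - (eB ℓ k Ms o b).1 = a.1 - b.1 := by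
  rw [eB_val, eB_val]; abel

omit [Fintype ι] [DecidableEq ι] in
/-- a site of `Ω` is the chart image of its back-translate: `x = eB(eB⁻¹x)`, in coordinates.
[cite: Balaban1983RegularityDecay, (1.1) p.572, dictionary] -/
theorem val_eq_symm_add (x : ↥(fineDom ((ℓ + 1) ^ k) (boxLabels Ms o))) :
    x.1 = ((eBquiv ℓ k Ms o).symm x).1 + fun i => (((ℓ + 1) ^ k : ℕ) : ℤ) * o i := by
  conv_lhs => rw [← (eBquiv ℓ k Ms o).apply_symm_apply x]
  rfl

omit [Fintype ι] [DecidableEq ι] in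
/-- **A COMPONENT FIELD READ THROUGH THE CHART IS THE TRANSLATED COMPONENT FIELD**: `A(eB u, eB v) = A^{(n·o)}(u, v)`
(p23's `shiftF`). [cite: Balaban1983RegularityDecay, p.572 «A_{⟨x,x+ηe_μ⟩} = A_μ(x)», dictionary] -/
theorem compField_eB (At : (Fin (d + 1) → ℤ) → Fin (d + 1) → ℝ) (u v : ↥(Box d ℓ k Ms)) :
    compField At (eB ℓ k Ms o u).1 (eB ℓ k Ms o v).1 = compField (shiftF ℓ k o At) u.1 v.1 :=
  compField_add At u.1 v.1 _

omit [Fintype ι] [DecidableEq ι] in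
/-- a fine point lies in `Ω` iff its back-translate lies in the box. [cite: Balaban1983RegularityDecay, (1.1) p.572, dictionary] -/
theorem add_mem_fineDom_iff (w : Fin (d + 1) → ℤ) :
    (w + fun i => (((ℓ + 1) ^ k : ℕ) : ℤ) * o i) ∈ fineDom ((ℓ + 1) ^ k) (boxLabels Ms o) ↔ w ∈ Box d ℓ k Ms := by
  constructor
  · intro h
    obtain ⟨a, ha⟩ := eB_surjective ℓ k Ms o ⟨_, h⟩
    have ha' := congrArg Subtype.val ha
    have : a.1 = w := add_right_cancel ha'
    rw [← this]; exact a.2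
  · intro h
    exact (eB ℓ k Ms o ⟨w, h⟩).2

variable (F : OrthFlow ι) {P : Fin (d + 1) → ℕ} (h3 : ∀ ν, 3 ≤ per ((ℓ + 1) ^ k) P ν)
  (hΩP : boxLabels Ms o ⊆ boxDom P) (hwrap : ∀ ν, Ms ν + 1 ≤ P ν)

include h3 hΩP hwrap in
/-- **`H^T_Ω(A)` RE-INDEXED ALONG THE CHART IS `opA` AT THE TRANSLATED PERIODIC FIELD** (proper parallelepiped of the
torus; p23's `regionOp_submatrix_eB` after `torusOp_eq_regionOp`).
[cite: Balaban1983RegularityDecay, (1.3)–(1.6) p.572 «operators on subsets of a torus T_η … a rectangular parallelepiped … with periodic conditions»] -/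
theorem torusOp_submatrix_eB (e a m2 : ℝ) (Ac : (Fin (d + 1) → ℤ) → Fin (d + 1) → ℝ) :
    (torusOp F e (hnk ℓ k) (B1.aSeq a ((ℓ : ℝ) + 1) k) m2 P (boxLabels Ms o) Ac).submatrix
        (Prod.map (eB ℓ k Ms o) id) (Prod.map (eB ℓ k Ms o) id)
      = opA d F (κS ℓ k e) ℓ k a m2 Ms (embS d ℓ k Ms) (ΓS d ℓ k Ms)
          (fun u v => compField (shiftF ℓ k o (perField ((ℓ + 1) ^ k) P Ac)) u.1 v.1) := by
  rw [torusOp_eq_regionOp (hnk ℓ k) h3 hΩP hwrap]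
  exact regionOp_submatrix_eB F e ℓ k a m2 Ms o _

include h3 hΩP hwrap in
/-- **`G^T_k(Ω, A)` RE-INDEXED ALONG THE CHART IS `greenA`**: the torus Green's function (1.6) of a proper
parallelepiped, read on the box, is the Lemma-2.2 lineage's `greenA` at the translated periodic field
(`Matrix.inv_submatrix_equiv`). [cite: Balaban1983RegularityDecay, (1.6) p.572 «G_k(Ω, A) = (…)^{−1}»] -/
theorem inv_torusOp_submatrix_eB (e a m2 : ℝ) (Ac : (Fin (d + 1) → ℤ) → Fin (d + 1) → ℝ) :
    ((torusOp F e (hnk ℓ k) (B1.aSeq a ((ℓ : ℝ) + 1) k) m2 P (boxLabels Ms o) Ac)⁻¹).submatrix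
        (eBι ℓ k Ms o) (eBι ℓ k Ms o)
      = greenA d F (κS ℓ k e) ℓ k a m2 Ms (embS d ℓ k Ms) (ΓS d ℓ k Ms)
          (fun u v => compField (shiftF ℓ k o (perField ((ℓ + 1) ^ k) P Ac)) u.1 v.1) := by
  rw [← Matrix.inv_submatrix_equiv, eBι_eq, torusOp_submatrix_eB ℓ k Ms o F h3 hΩP hwrap]
  rfl

omit [Fintype ι] in
/-- the covariant derivative of the region re-indexed along the chart is the box derivative at the pulled-back links.
[cite: Balaban1983RegularityDecay, (1.3) p.572] -/
theorem covDeriv_submatrix_eB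
    (W : ↥(fineDom ((ℓ + 1) ^ k) (boxLabels Ms o)) → ↥(fineDom ((ℓ + 1) ^ k) (boxLabels Ms o)) → Matrix ι ι ℝ)
    (μ : Fin (d + 1)) :
    (covDeriv ((ℓ + 1) ^ k) (fineDom ((ℓ + 1) ^ k) (boxLabels Ms o)) W μ).submatrix (eBι ℓ k Ms o) (eBι ℓ k Ms o)
      = covDeriv ((ℓ + 1) ^ k) (Box d ℓ k Ms) (fun a b => W (eB ℓ k Ms o a) (eB ℓ k Ms o b)) μ := by
  ext ⟨x, i⟩ ⟨z, j⟩
  rw [eBι_eq]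
  simp only [Matrix.submatrix_apply, Prod.map_apply, id_eq, covDeriv, blockOp_apply]
  have hmem : ((eB ℓ k Ms o x).1 + e1 μ ∈ fineDom ((ℓ + 1) ^ k) (boxLabels Ms o)) ↔ (x.1 + e1 μ ∈ Box d ℓ k Ms) := by
    rw [eB_val, add_right_comm]
    exact add_mem_fineDom_iff ℓ k Ms o _
  have heq : ((eB ℓ k Ms o z).1 = (eB ℓ k Ms o x).1 + e1 μ) ↔ (z.1 = x.1 + e1 μ) := by
    rw [eB_val, eB_val, add_right_comm]
    exact ⟨fun h => add_right_cancel h, fun h => by rw [h]⟩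
  have heq' : (eB ℓ k Ms o z = eB ℓ k Ms o x) ↔ (z = x) := (eBquiv ℓ k Ms o).injective.eq_iff
  unfold dirKer
  by_cases hx : x.1 + e1 μ ∈ Box d ℓ k Ms
  · rw [if_pos (hmem.2 hx), if_pos hx]
    by_cases hz : z.1 = x.1 + e1 μ
    · rw [if_pos (heq.2 hz), if_pos hz]
      by_cases hzx : z = x
      · rw [if_pos (heq'.2 hzx), if_pos hzx]
      · rw [if_neg (fun h => hzx (heq'.1 h)), if_neg hzx]
    · rw [if_neg (fun h => hz (heq.1 h)), if_neg hz]
      by_cases hzx : z = x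
      · rw [if_pos (heq'.2 hzx), if_pos hzx]
      · rw [if_neg (fun h => hzx (heq'.1 h)), if_neg hzx]
  · rw [if_neg (fun h => hx (hmem.1 h)), if_neg hx]

include h3 hΩP hwrap in
/-- **`D^T_{A,μ}` RE-INDEXED ALONG THE CHART IS `derivA` AT THE TRANSLATED PERIODIC FIELD** (proper parallelepiped of
the torus). [cite: Balaban1983RegularityDecay, (1.3) p.572] -/
theorem torusDeriv_submatrix_eB (e : ℝ) (Ac : (Fin (d + 1) → ℤ) → Fin (d + 1) → ℝ) (μ : Fin (d + 1)) :
    (torusDeriv F e ((ℓ + 1) ^ k) P (boxLabels Ms o) Ac μ).submatrix (eBι ℓ k Ms o) (eBι ℓ k Ms o)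
      = derivA d F (κS ℓ k e) ℓ k Ms
          (fun u v => compField (shiftF ℓ k o (perField ((ℓ + 1) ^ k) P Ac)) u.1 v.1) μ := by
  rw [torusDeriv_eq_regionDeriv (hnk ℓ k) h3 hΩP hwrap, regionDeriv, covDeriv_submatrix_eB]
  unfold derivA
  congr 1
  funext a b
  show F.U (_ * compField _ (eB ℓ k Ms o a).1 (eB ℓ k Ms o b).1) = F.U (_ * _)
  rw [compField_eB]
  rfl

/-! ## §3. Fields along the chart -/

omit [Fintype ι] [DecidableEq ι] in
/-- site values of a field read on the box (`f ∘ eBι`) along the chart. [cite: Balaban1983RegularityDecay, (1.9) p.573 «f : Ω → R^N», dictionary] -/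
theorem fld_comp_eBι (f : ↥(fineDom ((ℓ + 1) ^ k) (boxLabels Ms o)) × ι → ℝ) (z : ↥(Box d ℓ k Ms)) :
    fld (f ∘ ⇑(eBι (ι := ι) ℓ k Ms o)) z = fld f (eB ℓ k Ms o z) := rfl

omit [Fintype ι] [DecidableEq ι] in
/-- a difference read on the box. [cite: Balaban1983RegularityDecay, (1.11) p.573, dictionary] -/
theorem sub_comp_eBι (f g : ↥(fineDom ((ℓ + 1) ^ k) (boxLabels Ms o)) × ι → ℝ) :
    (f - g) ∘ ⇑(eBι (ι := ι) ℓ k Ms o) = f ∘ ⇑(eBι (ι := ι) ℓ k Ms o) - g ∘ ⇑(eBι (ι := ι) ℓ k Ms o) := rfl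

omit [DecidableEq ι] in
/-- **THE SUP NORM IS UNCHANGED BY THE CHART**: `‖f ∘ eB‖_∞ = ‖f‖_∞`. [cite: Balaban1983RegularityDecay, (1.9) p.573 «‖f‖_∞», dictionary] -/
theorem supN_comp_eBι (f : ↥(fineDom ((ℓ + 1) ^ k) (boxLabels Ms o)) × ι → ℝ) :
    supN (f ∘ ⇑(eBι (ι := ι) ℓ k Ms o)) = supN f := by
  unfold supN
  exact Equiv.iSup_congr (eBquiv ℓ k Ms o) fun z => rfl

omit [DecidableEq ι] in
/-- a re-indexed operator acts on fields read on the box as the operator acts upstairs (re-indexing plumbing for (1.6)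
read on representatives). [cite: Balaban1983RegularityDecay, (1.6) p.572 «identify with a rectangular parallelepiped», dictionary] -/
theorem submatrix_mulVec_comp_eBι
    (M : Matrix (↥(fineDom ((ℓ + 1) ^ k) (boxLabels Ms o)) × ι) (↥(fineDom ((ℓ + 1) ^ k) (boxLabels Ms o)) × ι) ℝ)
    (f : ↥(fineDom ((ℓ + 1) ^ k) (boxLabels Ms o)) × ι → ℝ) :
    M.submatrix (eBι ℓ k Ms o) (eBι ℓ k Ms o) *ᵥ (f ∘ ⇑(eBι (ι := ι) ℓ k Ms o))
      = (M *ᵥ f) ∘ ⇑(eBι (ι := ι) ℓ k Ms o) := by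
  rw [Matrix.submatrix_mulVec_equiv]
  have : (f ∘ ⇑(eBι (ι := ι) ℓ k Ms o)) ∘ ⇑(eBι (ι := ι) ℓ k Ms o).symm = f := by
    funext q; simp
  rw [this]

include h3 hΩP hwrap in
/-- **`(G^T_k(Ω,A)f) ∘ eB = greenA (f ∘ eB)`** on a proper parallelepiped of the torus.
[cite: Balaban1983RegularityDecay, (1.6) p.572, Theorem (1.10) p.573] -/
theorem inv_torusOp_mulVec_comp_eBι (e a m2 : ℝ) (Ac : (Fin (d + 1) → ℤ) → Fin (d + 1) → ℝ)
    (f : ↥(fineDom ((ℓ + 1) ^ k) (boxLabels Ms o)) × ι → ℝ) :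
    ((torusOp F e (hnk ℓ k) (B1.aSeq a ((ℓ : ℝ) + 1) k) m2 P (boxLabels Ms o) Ac)⁻¹ *ᵥ f) ∘ ⇑(eBι (ι := ι) ℓ k Ms o)
      = greenA d F (κS ℓ k e) ℓ k a m2 Ms (embS d ℓ k Ms) (ΓS d ℓ k Ms)
          (fun u v => compField (shiftF ℓ k o (perField ((ℓ + 1) ^ k) P Ac)) u.1 v.1)
          *ᵥ (f ∘ ⇑(eBι (ι := ι) ℓ k Ms o)) := by
  rw [← inv_torusOp_submatrix_eB ℓ k Ms o F h3 hΩP hwrap, submatrix_mulVec_comp_eBι]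

include h3 hΩP hwrap in
/-- **`(D^T_{A,μ}v) ∘ eB = derivA (v ∘ eB)`** on a proper parallelepiped of the torus.
[cite: Balaban1983RegularityDecay, (1.3) p.572] -/
theorem torusDeriv_mulVec_comp_eBι (e : ℝ) (Ac : (Fin (d + 1) → ℤ) → Fin (d + 1) → ℝ) (μ : Fin (d + 1))
    (v : ↥(fineDom ((ℓ + 1) ^ k) (boxLabels Ms o)) × ι → ℝ) :
    (torusDeriv F e ((ℓ + 1) ^ k) P (boxLabels Ms o) Ac μ *ᵥ v) ∘ ⇑(eBι (ι := ι) ℓ k Ms o)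
      = derivA d F (κS ℓ k e) ℓ k Ms
          (fun u v => compField (shiftF ℓ k o (perField ((ℓ + 1) ^ k) P Ac)) u.1 v.1) μ
          *ᵥ (v ∘ ⇑(eBι (ι := ι) ℓ k Ms o)) := by
  rw [← torusDeriv_submatrix_eB ℓ k Ms o F h3 hΩP hwrap, submatrix_mulVec_comp_eBι]

omit [Fintype ι] [DecidableEq ι] in
/-- transport along a mapped chain is transport with the pulled-back links (the transporter `U(A(Γ))` read through a
chart). [cite: Balaban1983RegularityDecay, (1.4) p.572 «U(A(Γ))», dictionary] -/
theorem transport_map {X X' : Type} [Fintype ι] [DecidableEq ι] (W : X → X → Matrix ι ι ℝ) (g : X' → X) (x : X')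
    (l : List X') : transport W (g x) (l.map g) = transport (fun a b => W (g a) (g b)) x l := by
  induction l generalizing x with
  | nil => rfl
  | cons y l ih => simp only [List.map_cons, transport, ih]

omit [Fintype ι] [DecidableEq ι] in
/-- a nearest-neighbour chain of the box is a path for the relation «lattice neighbours» (two spellings of the
lineage's contours). [cite: Balaban1983RegularityDecay, p.573 «Γ_{x,x′} denotes a shortest contour», dictionary] -/
theorem pathRel_of_isNNChain {R : Finset (Fin (d + 1) → ℤ)} :
    ∀ (x : ↥R) (l : List ↥R), IsNNChain x l → PathRel (fun u v : ↥R => v.1 ∈ nbrs u.1) x l := by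
  intro x l
  induction l generalizing x with
  | nil => intro _; trivial
  | cons y l ih => rintro ⟨hxy, hl⟩; exact ⟨hxy, ih y hl⟩

omit [Fintype ι] [DecidableEq ι] in
/-- the end point of a contour read through a chart is the chart image of its end point. [cite: Balaban1983RegularityDecay, p.573 «Γ_{x,x′} … contour connecting these points», dictionary] -/
theorem pathEnd_map {X X' : Type} (g : X' → X) (x : X') (l : List X') :
    pathEnd (g x) (l.map g) = g (pathEnd x l) := by
  induction l generalizing x with
  | nil => rfl
  | cons y l ih => simp only [List.map_cons, pathEnd, ih]

include h3 hΩP in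
/-- **TRANSPORTERS ALONG THE CHART**: for a nearest-neighbour chain `Γ` of the box, the torus transporter `U(A(eB Γ))`
(torus links of `Ω`) is the box transporter `U(Ã(Γ))` at the translated periodic component field — the steps of
`eB Γ` are lattice bonds of the period box, on which the torus field is the periodic component field.
[cite: Balaban1983RegularityDecay, (1.4) p.572 «U(A(Γ))», p.572 «A_{⟨x,x+ηe_μ⟩} = A_μ(x)»] -/
theorem transport_eB (κ : ℝ) (Ac : (Fin (d + 1) → ℤ) → Fin (d + 1) → ℝ) (x : ↥(Box d ℓ k Ms))
    (l : List ↥(Box d ℓ k Ms)) (hl : IsNNChain x l) :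
    transport (fieldLink F κ fun a b : ↥(fineDom ((ℓ + 1) ^ k) (boxLabels Ms o)) =>
        torBond ((ℓ + 1) ^ k) P Ac a.1 b.1) (eB ℓ k Ms o x) (l.map (eB ℓ k Ms o))
      = transport (fieldLink F κ fun a b : ↥(Box d ℓ k Ms) =>
          compField (shiftF ℓ k o (perField ((ℓ + 1) ^ k) P Ac)) a.1 b.1) x l := by
  rw [transport_map]
  refine transport_congr (r := fun u v : ↥(Box d ℓ k Ms) => v.1 ∈ nbrs u.1) (fun u v huv => ?_) x l
    (pathRel_of_isNNChain x l hl)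
  have hnb : (eB ℓ k Ms o v).1 ∈ nbrs (eB ℓ k Ms o u).1 := by
    rw [eB_val, eB_val]; exact (mem_nbrs_add_iff _ _ _).2 huv
  rw [fieldLink_tor_eq_of_nbrs F (hnk ℓ k) h3 hΩP κ Ac hnb]
  show F.U (_ * compField _ (eB ℓ k Ms o u).1 (eB ℓ k Ms o v).1) = F.U (_ * _)
  rw [compField_eB]

omit [Fintype ι] [DecidableEq ι] in
include hΩP hwrap in
/-- **A TORUS CHAIN OF `Ω` READ ON THE BOX IS A NEAREST-NEIGHBOUR CHAIN OF THE BOX** (no bond of a proper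
parallelepiped wraps around). [cite: Balaban1983RegularityDecay, p.573 «Γ_{x,x′} … contour», p.572 «periodic conditions», dictionary] -/
theorem isNNChain_map_symm : ∀ (x : ↥(fineDom ((ℓ + 1) ^ k) (boxLabels Ms o)))
    (l : List ↥(fineDom ((ℓ + 1) ^ k) (boxLabels Ms o))),
    PathRel (fun u v : ↥(fineDom ((ℓ + 1) ^ k) (boxLabels Ms o)) => TNbr ((ℓ + 1) ^ k) P u.1 v.1) x l →
      IsNNChain ((eBquiv ℓ k Ms o).symm x) (l.map (eBquiv ℓ k Ms o).symm) := by
  intro x l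
  induction l generalizing x with
  | nil => intro _; simp [IsNNChain]
  | cons y l ih =>
      rintro ⟨hxy, hl⟩
      refine ⟨?_, ih y hl⟩
      have hnb : y.1 ∈ nbrs x.1 := nbrs_of_tNbr (hnk ℓ k) hΩP hwrap x.2 y.2 hxy
      rw [val_eq_symm_add ℓ k Ms o x, val_eq_symm_add ℓ k Ms o y] at hnb
      exact (mem_nbrs_add_iff _ _ _).1 hnb

include h3 hΩP hwrap in
/-- **TRANSPORTERS OF TORUS CHAINS OF `Ω`, READ ON THE BOX**: for a chain `Γ` of torus bonds of the proper
parallelepiped `Ω` from `x`, `U(A(Γ)) = U(Ã(eB⁻¹Γ))` with `Ã` the translated periodic component field.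
[cite: Balaban1983RegularityDecay, (1.4) p.572 «U(A(Γ))», (1.9) p.573 «U(A(Γ_{x,x′}))»] -/
theorem transport_eq_transport_symm (κ : ℝ) (Ac : (Fin (d + 1) → ℤ) → Fin (d + 1) → ℝ)
    (x : ↥(fineDom ((ℓ + 1) ^ k) (boxLabels Ms o))) (l : List ↥(fineDom ((ℓ + 1) ^ k) (boxLabels Ms o)))
    (hl : PathRel (fun u v : ↥(fineDom ((ℓ + 1) ^ k) (boxLabels Ms o)) => TNbr ((ℓ + 1) ^ k) P u.1 v.1) x l) :
    transport (fieldLink F κ fun a b : ↥(fineDom ((ℓ + 1) ^ k) (boxLabels Ms o)) =>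
        torBond ((ℓ + 1) ^ k) P Ac a.1 b.1) x l
      = transport (fieldLink F κ fun a b : ↥(Box d ℓ k Ms) =>
          compField (shiftF ℓ k o (perField ((ℓ + 1) ^ k) P Ac)) a.1 b.1)
          ((eBquiv ℓ k Ms o).symm x) (l.map (eBquiv ℓ k Ms o).symm) := by
  have h := transport_eB ℓ k Ms o F h3 hΩP κ Ac ((eBquiv ℓ k Ms o).symm x)
    (l.map (eBquiv ℓ k Ms o).symm) (isNNChain_map_symm ℓ k Ms o hΩP hwrap x l hl)
  have hmap : (l.map (eBquiv ℓ k Ms o).symm).map (eB ℓ k Ms o) = l := by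
    rw [List.map_map]
    conv_rhs => rw [← List.map_id l]
    refine List.map_congr_left fun z _ => ?_
    exact (eBquiv ℓ k Ms o).apply_symm_apply z
  have hx : eB ℓ k Ms o ((eBquiv ℓ k Ms o).symm x) = x := (eBquiv ℓ k Ms o).apply_symm_apply x
  rw [hmap, hx] at h
  exact h

end BoxChart

end

end Literature.MathematicalPhysics.QuantumFieldTheory.Balaban1983to89.B4TorusBoxReindex
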